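import Literature.AnabelianGeometry.EtaleTheta.Discharge.Sec2CuspDecompositionReduction
import Literature.AnabelianGeometry.EtaleTheta.ThetaCoversCommutatorTheta
import HarnessLib

/-!
# [EtTh] Rmk 2.6.1 / Cor 2.9: the `hΘ` consumers RE-KEYED to the named predicate `CoverData.IsCommutatorTheta`
# (L2 13:00Z census item C13, predicate route; abc-iut-L2-lead R337)

Mochizuki, *The étale theta function …*, Publ. RIMS **45** (2009), §1 p. 12 («`Δ_Θ := Im(∧² Δ^ab_X)`»),
Def. 2.1 p. 35, Rmk. 2.6.1 p. 40, Cor. 2.9 p. 43 [cite: MochizukiEtTh2009, Rmk 2.6.1 p.40]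
[cite: MochizukiEtTh2009, Cor 2.9 p.43]. Cell abc-iut, seat abc-iut-w6-d092 (gen 4); PROOF-ONLY (0 `def`).
abc-iut-L2-d3's discharges of Rmk 2.6.1 / Cor 2.9 (`Sec2AutKHolds`, `Sec2AutKDotted`,
`Sec2CuspDecompositionReduction`) take the printed definition of `Δ̄_Θ` as the raw binder
`hΘ : ⁅Δ_X, Δ_X⁆ ⊔ barKer = barTheta`; abc-iut-L2-t2's census predicate `CoverData.IsCommutatorTheta`
(`ThetaCoversCommutatorTheta.lean`, p442558) NAMES that clause. This file re-keys every such consumer to the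
predicate (one line each: `h.commutator_sup_barKer`), so tokens and NV lines cite ONE decl. Nothing of the
owners' files is edited or restated. HONEST FRAMING: bookkeeping; naming a clause asserts nothing; no side
taken on [IUTchIII] Cor. 3.12; typed ≠ proved.
-/

namespace Literature.AnabelianGeometry.EtaleTheta.ThetaCovers.TemperedCoverData

open Literature.AnabelianGeometry.SemiGraphs
open Literature.AlgebraicGeometry.Frobenioids (IsSlimGroup)
open Subgroup.Commensurable (commensurator)

universe u

variable {l : ℕ} (T : TemperedCoverData.{u} l)

/-- `Aut_K(C̲̲^log) ≅ μ_l` (Rmk 2.6.1) from `IsCommutatorTheta` and `HasMuL`. [cite: MochizukiEtTh2009, Rmk 2.6.1 p.40] -/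
theorem nonempty_autK_tpPiCuu_mulEquiv_of_isCommutatorTheta (h : T.IsCommutatorTheta) (hmu : T.HasMuL) :
    Nonempty (T.autK (T.tp T.PiCuu) ≃* Multiplicative (ZMod l)) :=
  T.nonempty_autK_tpPiCuu_mulEquiv h.commutator_sup_barKer hmu

/-- `Aut_K(X̲̲^log) ≅ μ_l × {±1}` (Rmk 2.6.1) from `IsCommutatorTheta` and `HasMuL`.
[cite: MochizukiEtTh2009, Rmk 2.6.1 p.40] -/
theorem nonempty_autK_tpPiXuu_mulEquiv_of_isCommutatorTheta (h : T.IsCommutatorTheta) (hmu : T.HasMuL) :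
    Nonempty (T.autK (T.tp T.PiXuu) ≃* Multiplicative (ZMod l) × Multiplicative (ZMod 2)) :=
  T.nonempty_autK_tpPiXuu_mulEquiv h.commutator_sup_barKer hmu

/-- **Remark 2.6.1** (the typed `Rmk261`) from `IsCommutatorTheta` (abc-iut-L2-d3's `rmk261_of`, re-keyed).
[cite: MochizukiEtTh2009, Rmk 2.6.1 p.40] -/
theorem rmk261_of_isCommutatorTheta [NeZero l] (h : T.IsCommutatorTheta) : T.Rmk261 :=
  T.rmk261_of h.commutator_sup_barKer

/-- **Remark 2.6.1, dotted members** (`Rmk261_dotted`) from temp-slimness of `Π^tp_C`, Prop. 2.6 and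
`IsCommutatorTheta` (abc-iut-L2-d3's `rmk261_dotted_of`, re-keyed). [cite: MochizukiEtTh2009, Rmk 2.6.1 p.40] -/
theorem rmk261_dotted_of_isCommutatorTheta [NeZero l] (hslim : IsSlimGroup T.Gtp) (h26 : T.Prop26)
    (h : T.IsCommutatorTheta) : T.Rmk261_dotted :=
  T.rmk261_dotted_of hslim h26 h.commutator_sup_barKer

/-- **Cor 2.9 for `X̲̲`**: `#(Aut_K(X̲̲)-orbits of cusps) = (l+1)/2` from `IsCommutatorTheta`, `HasMuL` and the cusp
hypotheses `hC1`, `hC2`. [cite: MochizukiEtTh2009, Cor 2.9 p.43] -/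
theorem natCard_cuspOrbits_tpPiXuu_of_isCommutatorTheta (h : T.IsCommutatorTheta) (hmu : T.HasMuL)
    (hC1 : T.cuspStabC ⊓ T.tp T.PiX ≤ T.tp T.PiXu) (hC2 : ¬ T.cuspStabC ≤ T.tp T.PiX) :
    Nat.card (T.cuspOrbits (T.tp T.PiXuu)) = (l + 1) / 2 :=
  T.natCard_cuspOrbits_tpPiXuu h.commutator_sup_barKer hmu hC1 hC2

/-- **Cor 2.9, undotted members** from `IsCommutatorTheta` and the cusp hypotheses (abc-iut-L2-d3's
`cor29_card_undotted_of`, re-keyed). [cite: MochizukiEtTh2009, Cor 2.9 p.43] -/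
theorem cor29_card_undotted_of_isCommutatorTheta (h : T.IsCommutatorTheta)
    (hC1 : T.cuspStabC ⊓ T.tp T.PiX ≤ T.tp T.PiXu) (hC2 : ¬ T.cuspStabC ≤ T.tp T.PiX) :
    T.HasMuL → ∀ S ∈ [T.tp T.PiXuu, T.tp T.PiCu, T.tp T.PiCuu], Nat.card (T.cuspOrbits S) = (l + 1) / 2 :=
  T.cor29_card_undotted_of h.commutator_sup_barKer hC1 hC2

/-- **[EtTh] Corollary 2.9** (the typed `Cor29_card`, all six members) from temp-slimness, Prop. 2.6,
`IsCommutatorTheta` and the cusp hypotheses (abc-iut-L2-d3's `cor29_card_of`, re-keyed).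
[cite: MochizukiEtTh2009, Cor 2.9 p.43] -/
theorem cor29_card_of_isCommutatorTheta (hslim : IsSlimGroup T.Gtp) (h26 : T.Prop26)
    (h : T.IsCommutatorTheta) (hC1 : T.cuspStabC ⊓ T.tp T.PiX ≤ T.tp T.PiXu)
    (hC2 : ¬ T.cuspStabC ≤ T.tp T.PiX) : T.Cor29_card :=
  T.cor29_card_of hslim h26 h.commutator_sup_barKer hC1 hC2

variable {T}

/-- **Cor 2.9, undotted members, cusp hypotheses discharged from the `D^tp_{x_C}` data (B1)–(B3)**, keyed to
`IsCommutatorTheta` (`cor29_card_undotted_of_cuspDecomp`, re-keyed). [cite: MochizukiEtTh2009, Cor 2.9 p.43] -/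
theorem cor29_card_undotted_of_cuspDecomp_of_isCommutatorTheta {DC : Subgroup T.Gtp}
    (h : T.IsCommutatorTheta) (hDCX : DC ⊓ T.tp T.PiX = T.tp T.Dx) (hι : ¬ DC ≤ T.tp T.PiX)
    (hct : commensurator DC ≤ DC) :
    T.HasMuL → ∀ S ∈ [T.tp T.PiXuu, T.tp T.PiCu, T.tp T.PiCuu], Nat.card (T.cuspOrbits S) = (l + 1) / 2 :=
  cor29_card_undotted_of_cuspDecomp h.commutator_sup_barKer hDCX hι hct

/-- **[EtTh] Corollary 2.9 (all six members), cusp hypotheses discharged from (B1)–(B3)**, keyed to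
`IsCommutatorTheta` (`cor29_card_of_cuspDecomp`, re-keyed). [cite: MochizukiEtTh2009, Cor 2.9 p.43] -/
theorem cor29_card_of_cuspDecomp_of_isCommutatorTheta {DC : Subgroup T.Gtp} (hslim : IsSlimGroup T.Gtp)
    (h26 : T.Prop26) (h : T.IsCommutatorTheta) (hDCX : DC ⊓ T.tp T.PiX = T.tp T.Dx)
    (hι : ¬ DC ≤ T.tp T.PiX) (hct : commensurator DC ≤ DC) : T.Cor29_card :=
  cor29_card_of_cuspDecomp hslim h26 h.commutator_sup_barKer hDCX hι hct

end Literature.AnabelianGeometry.EtaleTheta.ThetaCovers.TemperedCoverData
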